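import Summits.QuantumFields.BalabanUV.T4Continuum.Support.NE7PairwiseOffsetEndWindow

/-!
# NE7PairwiseOffsetEndSeq — row NE7 (node U5), route «PAIR-CAUCHY» (R-P2, 1-bis): the SEQUENCE-INDEXED offset
# socket — good clauses, remainders and bad-class weights that may depend on the finer-run SEQUENCE `ν`, and the
# diagonal argument that makes uniformity over the finer run a THEOREM rather than an ask

Cell `pub-balaban`, rung (B)+1 sub-cell t4, lineage `b2b-balaban-t4-ne7-p2` (CRUX PROVER NE7 #2 under the
coordinator ruling «YM redirect», 2026-08-21; generation 55; texts: `HOME/t4/b2b-balaban-t4-ne7-p2/g55/ROUTE2-NE7-P2.md`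
v1.10 §3 (the cost line «uniformity of the two-run moduli in the transport iterate n = K′ − K + 1 (new, mild)») and §13,
the crux refuter's `HOME/b2b-balaban-t4-ne7-refuter/PRICING-NE7.md` v10 §55 («WHERE THE MATHEMATICS SITS … in `hgood` —
ONE modulus δ w K for the pair (A_K, B_K^{K+n}) UNIFORM IN n»), and the headers of `Support/NE7PairwiseOffsetEndWindow`
(p259223), `Support/NE7PairwiseCouplingDock` (p249585: the dock is stated for an ARBITRARY offset sequence) and
`Support/NE7PairwiseCouplingUniform` (p250419: `uniform_of_forall_seq`, the diagonal argument for real gaps).  HONEST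
FRAMING (page 1): FIXED FINITE T⁴, rung (B)+1 = existence AND uniqueness of the `ε = L^{−K} → 0` limit of unit-scale
averaged expectations, CONDITIONAL on BetaPertH and the nine spine estimates (0/9 proved); NOT infinite volume, NOT a
mass gap, NOT the Clay problem.  NE7 is NOT PRINTED in [Balaban1984PropagatorsI]–[Balaban1989LargeFieldII] and NOT proved
here.  Everything below is [folklore] logic and bookkeeping over HYPOTHESIS SHAPES (abstract finite families of reals);
no definition, no cite tag, nothing printed asserted, no `sorry`.

WHY.  The windowed ∕ K-only socket `NE7PairwiseOffsetEndWindow.pairCauchy_of_kOnlyBadClasses` (p259223) asks, at each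
window depth `w`, for road P1's `GoodClause` for the offset family `(A, K ↦ B K (K + n))` for every CONSTANT offset `n`
with ONE remainder `δ w K` serving all `n` — a common, `n`-free majorant.  The two-run suppliers of this route, however,
are typed «a run against ANY finer run»: the dock `couplingGap_tendsto_zero` and leaves T.3♭ ∕ T.4♭ ∕ T.5♭ deliver, for
every offset SEQUENCE `ν : ℕ → ℕ` (finer partner `K + ν K`), a null modulus that may depend on `ν`.  ROUTE2 §3 therefore
listed «uniformity of the two-run moduli in the transport iterate n» as a (mild) COST of the pairwise organisation.  This
file removes that line: §1 proves, at the level of predicates, that «for every finer-run sequence `ν`, eventually in `K`,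
`P K (ν K)`» is EQUIVALENT to «eventually in `K`, `P K n` for all `n` at once» (the diagonal argument of p250419 lifted
from real gaps to propositions; pairs form: `∃ K₀, ∀ K₀ ≤ K ≤ K′, Q K K′ ⟺ ∀ ν, ∀ᶠ K, Q K (K + ν K)`; and a common NULL
MAJORANT of per-sequence null moduli exists eventually), and §2 re-states the socket with EVERYTHING two-run indexed by
the sequence — good clauses `GoodClause l₀ vol T A (K ↦ B K (K + ν K)) (Bad w ν) (δ w ν)`, remainders `δ w ν K → 0`,
bad classes `Bad w ν K t ⊆ T K` with weights `W w ν K`, `W w ν K ≤ η w` eventually — and the SAME `ε–K₀` pair-Cauchy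
conclusion; no common majorant is asked of anybody.  §3 specialises to the K-ONLY printed type (bad class `Bad w K t` and
one-run weight `W w K` of run `K`, n-free; only the good-clause remainder indexed by `ν`) and exits at node U6 ∕ U0 by
name; §4 re-derives p259223's constant-offset socket as the special case `ν ≡ n` (consistency: the new socket is a
GENERALISATION, its hypotheses are implied by the old ones).

WHAT IS PROVED ([folklore]).
§1 `eventually_forall_of_forall_seq`, `forall_seq_of_eventually_forall`, **`eventually_forall_iff_forall_seq`**,
   **`pairs_eventually_iff_forall_seq`** (pairs `K ≤ K′` ↔ offset sequences), `eventually_forall_lt_of_forall_seq`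
   (the real-gap form, = p250419's `uniform_of_forall_seq` in filter language), **`exists_common_null_majorant`**
   (per-sequence null moduli ⟹ ONE null `D` with `a K n ≤ D K` for all `n`, eventually in `K`).
§2 `pairBound_of_seqGoodClause` (one sequence, one pair: the hybrid sandwich for `(K, K + ν K)` and
   `T4HybridMatching.HybridSandwich.abs_log_sum_sub_le`), **`pairCauchy_of_seqOffsetGoodClauses`** (the sequence-indexed
   socket ⟹ pair-Cauchy: window first, then §1's pairs form at that window).
§3 **`pairCauchy_of_seqKOnlyBadClasses`** (K-only bad classes, sequence-indexed remainders), exits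
   **`genFunCauchy_of_seqKOnlyBadClasses`** (node U6 `T4Assembly.GenFunCauchy S l₀`),
   `hasContinuumLimit_of_seqKOnlyBadClasses` (node U0).
§4 `pairCauchy_of_kOnlyBadClasses'` — p259223 §2 as the constant-sequence case of §3 (same statement, new proof).

NOT DELIVERED: the per-sequence good clauses for Bałaban's runs (road P1's END applied to `(A, B·ν)` — (E♭-inst) kind (i),
the identification of P1's windowed class with a level union of run `K`'s label; kind (ii), the per-level suppression
summable in the level index — rows NE7b ∕ NE7c; both SUPPLIER asks in the null currency, unchanged except that no
`n`-uniformity clause rides on them any more), NODE O (road P1's, inherited verbatim).  NOT NE7 (spine 0/9 unchanged),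
NOT summit progress.  HONEST DEPENDENCY: continuum YM on T⁴ ⇐ BetaPertH ∧ nine spine estimates (0/9 proved); BetaPertH ⇐
(D1) ∧ (D4) ∧ CAP+tail; G-an2-4 gates asym, D1 and NE2/3/4.
-/

noncomputable section

open Finset Filter Topology
open scoped BigOperators

namespace Summit.QuantumFields.BalabanUV.T4Continuum.NE7PairwiseOffsetEndSeq

open Literature.MathematicalPhysics.QuantumFieldTheory
open Literature.MathematicalPhysics.QuantumFieldTheory.Balaban1983to89
open T4HybridMatching (HybridSandwich)
open T4GoodClassBudget (GoodClause)
open Summit.QuantumFields.BalabanUV.T4Continuum.NE7PairwiseCauchyWindow (cauchySeq_genFun_of_pairCauchy)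

/-! ## §1 Uniformity over the finer run is free: the diagonal argument at the level of predicates -/

section Uniformisation

/-- **THE DIAGONAL ARGUMENT, PROP LEVEL.**  If for EVERY offset sequence `ν : ℕ → ℕ` the property `P K (ν K)` holds
eventually in `K`, then eventually in `K` it holds for ALL offsets `n` at once (choose, at each `K`, a bad offset when
there is one; that sequence is not eventually good). [folklore] -/
theorem eventually_forall_of_forall_seq {P : ℕ → ℕ → Prop} (h : ∀ ν : ℕ → ℕ, ∀ᶠ K in atTop, P K (ν K)) :
    ∀ᶠ K in atTop, ∀ n, P K n := by
  classical
  -- the diagonal offset sequence: a bad offset where one exists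
  let ν : ℕ → ℕ := fun K => if hK : ∃ n, ¬P K n then Classical.choose hK else 0
  have hν : ∀ K, (∃ n, ¬P K n) → ¬P K (ν K) := fun K hK => by
    simp only [ν, dif_pos hK]
    exact Classical.choose_spec hK
  obtain ⟨K₀, hK₀⟩ := eventually_atTop.1 (h ν)
  refine eventually_atTop.2 ⟨K₀, fun K hK => ?_⟩
  by_contra hK'
  exact hν K (not_forall.1 hK') (hK₀ K hK)

/-- The converse (trivial): an eventual statement for all offsets holds along every sequence. [folklore] -/
theorem forall_seq_of_eventually_forall {P : ℕ → ℕ → Prop} (h : ∀ᶠ K in atTop, ∀ n, P K n) (ν : ℕ → ℕ) :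
    ∀ᶠ K in atTop, P K (ν K) :=
  h.mono fun K hK => hK (ν K)

/-- **SEQUENCES ⟺ ALL OFFSETS.** [folklore] -/
theorem eventually_forall_iff_forall_seq {P : ℕ → ℕ → Prop} :
    (∀ᶠ K in atTop, ∀ n, P K n) ↔ ∀ ν : ℕ → ℕ, ∀ᶠ K in atTop, P K (ν K) :=
  ⟨forall_seq_of_eventually_forall, eventually_forall_of_forall_seq⟩

/-- **PAIRS FORM.**  A property of pairs of runs `K ≤ K′` holds for ALL pairs beyond some `K₀` iff for EVERY offset
sequence `ν` it holds eventually along the pairs `(K, K + ν K)` — «a run against any finer run» IS uniformity over the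
finer run. [folklore] -/
theorem pairs_eventually_iff_forall_seq {Q : ℕ → ℕ → Prop} :
    (∃ K₀ : ℕ, ∀ K K' : ℕ, K₀ ≤ K → K ≤ K' → Q K K') ↔ ∀ ν : ℕ → ℕ, ∀ᶠ K in atTop, Q K (K + ν K) := by
  constructor
  · rintro ⟨K₀, hK₀⟩ ν
    exact eventually_atTop.2 ⟨K₀, fun K hK => hK₀ K (K + ν K) hK (Nat.le_add_right K (ν K))⟩
  · intro h
    obtain ⟨K₀, hK₀⟩ :=
      eventually_atTop.1 (eventually_forall_of_forall_seq (P := fun K n => Q K (K + n)) h)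
    refine ⟨K₀, fun K K' hK hKK' => ?_⟩
    obtain ⟨n, rfl⟩ := Nat.exists_eq_add_of_le hKK'
    exact hK₀ K hK n

/-- The real-gap form (= `NE7PairwiseCouplingUniform.uniform_of_forall_seq` in filter language): per-sequence null gaps
⟹ eventually all gaps below `ε`. [folklore] -/
theorem eventually_forall_lt_of_forall_seq {a : ℕ → ℕ → ℝ}
    (h : ∀ ν : ℕ → ℕ, Tendsto (fun K => a K (ν K)) atTop (𝓝 0)) {ε : ℝ} (hε : 0 < ε) :
    ∀ᶠ K in atTop, ∀ n, a K n < ε :=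
  eventually_forall_of_forall_seq fun ν => (h ν).eventually (Iio_mem_nhds hε)

/-- **A COMMON NULL MAJORANT.**  If along every offset sequence the modulus `a K (ν K)` is null, then there is ONE null
sequence `D` with `a K n ≤ D K` for all `n`, eventually in `K` (take `D K := sup_n a K n`, finite eventually by the
diagonal argument; null by squeezing between `a K 0` and `ε`).  So «one modulus for all offsets» is never an extra ask
over «a null modulus along every finer-run sequence». [folklore] -/
theorem exists_common_null_majorant {a : ℕ → ℕ → ℝ}
    (h : ∀ ν : ℕ → ℕ, Tendsto (fun K => a K (ν K)) atTop (𝓝 0)) :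
    ∃ D : ℕ → ℝ, Tendsto D atTop (𝓝 0) ∧ ∀ᶠ K in atTop, ∀ n, a K n ≤ D K := by
  have hbdd : ∀ᶠ K in atTop, BddAbove (Set.range (a K)) :=
    (eventually_forall_lt_of_forall_seq h one_pos).mono fun K hK =>
      ⟨1, by rintro _ ⟨n, rfl⟩; exact (hK n).le⟩
  refine ⟨fun K => ⨆ n, a K n, ?_, hbdd.mono fun K hK n => le_ciSup hK n⟩
  rw [tendsto_order]
  refine ⟨fun b hb => ?_, fun b hb => ?_⟩
  · -- lower side: `a K 0 ≤ D K` eventually and `a K 0 → 0`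
    have h0 : ∀ᶠ K in atTop, b < a K 0 := (h fun _ => 0).eventually (Ioi_mem_nhds hb)
    filter_upwards [h0, hbdd] with K hK hKb
    exact lt_of_lt_of_le hK (le_ciSup hKb 0)
  · -- upper side: all gaps `< b∕2` eventually, hence the supremum `≤ b∕2 < b`
    filter_upwards [eventually_forall_lt_of_forall_seq h (half_pos hb)] with K hK
    exact lt_of_le_of_lt (ciSup_le fun n => (hK n).le) (half_lt_self hb)

end Uniformisation

/-! ## §2 The sequence-indexed socket: everything two-run may depend on the finer-run sequence -/

section Seq

variable {ι : Type*} [DecidableEq ι] {l₀ vol : ℝ} {T : ℕ → Finset ι} {A : ℕ → ℝ → ι → ℝ}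
  {B : ℕ → ℕ → ℝ → ι → ℝ} {Z : ℕ → ℝ → ℝ}

/-- **ONE SEQUENCE, ONE PAIR.**  Along the offset sequence `ν` (finer partner `K + ν K`): road P1's `GoodClause` for the
family `(A, K ↦ B K (K + ν K))` with bad classes `Bd K t ⊆ T K` of relative weight `≤ Wν K` in run `K` and in the
partner fibre-summed, `Wν K < 1`, nonnegativity, positivity ⟹ for every `K`,
`|log Z (K + ν K) t − log Z K t − c| ≤ vol·δν K − log(1 − Wν K)` on `|t| ≤ l₀` (the hybrid sandwich of the pair and
`T4HybridMatching.HybridSandwich.abs_log_sum_sub_le`). [folklore] -/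
theorem pairBound_of_seqGoodClause (ν : ℕ → ℕ) {Bd : ℕ → ℝ → Finset ι} {δν Wν : ℕ → ℝ}
    (hZA : ∀ (K : ℕ) (t : ℝ), |t| ≤ l₀ → Z K t = ∑ τ ∈ T K, A K t τ)
    (hZB : ∀ (K K' : ℕ) (t : ℝ), K ≤ K' → |t| ≤ l₀ → Z K' t = ∑ τ ∈ T K, B K K' t τ)
    (hpos : ∀ (K : ℕ) (t : ℝ), |t| ≤ l₀ → 0 < ∑ τ ∈ T K, A K t τ) (hW1 : ∀ K, Wν K < 1)
    (hA : ∀ K t, |t| ≤ l₀ → ∀ τ ∈ T K, 0 ≤ A K t τ)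
    (hB : ∀ K K' t, K ≤ K' → |t| ≤ l₀ → ∀ τ ∈ T K, 0 ≤ B K K' t τ)
    (hbad : ∀ K t, |t| ≤ l₀ → Bd K t ⊆ T K)
    (hWA : ∀ K t, |t| ≤ l₀ → ∑ τ ∈ Bd K t, A K t τ ≤ Wν K * ∑ τ ∈ T K, A K t τ)
    (hWB : ∀ K t, |t| ≤ l₀ → ∑ τ ∈ Bd K t, B K (K + ν K) t τ ≤ Wν K * ∑ τ ∈ T K, B K (K + ν K) t τ)
    (hgood : GoodClause l₀ vol T A (fun K => B K (K + ν K)) Bd δν) (K : ℕ) :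
    ∃ c : ℝ, ∀ t : ℝ, |t| ≤ l₀ →
      |Real.log (Z (K + ν K) t) - Real.log (Z K t) - c| ≤ vol * δν K - Real.log (1 - Wν K) := by
  obtain ⟨c, hc⟩ := hgood K
  refine ⟨c, fun t ht => ?_⟩
  have hKK' : K ≤ K + ν K := Nat.le_add_right K (ν K)
  have hsd : T K \ (T K \ Bd K t) = Bd K t := Finset.sdiff_sdiff_eq_self (hbad K t ht)
  have hS : HybridSandwich (T K) (T K \ Bd K t) (A K t) (B K (K + ν K) t) c (vol * δν K) (Wν K) :=
    { subset := Finset.sdiff_subset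
      nonneg_left := hA K t ht
      nonneg_right := hB K (K + ν K) t hKK' ht
      lower := fun τ hτ => (hc t ht τ hτ).1
      upper := fun τ hτ => (hc t ht τ hτ).2
      bad_left := by rw [hsd]; exact hWA K t ht
      bad_right := by rw [hsd]; exact hWB K t ht }
  rw [hZA K t ht, hZB K (K + ν K) t hKK' ht]
  exact hS.abs_log_sum_sub_le (hW1 K) (hpos K t ht)

/-- `−log(1 − η w) → 0` along `η → 0` (the window step of `NE7PairwiseCauchyWindow.pairCauchy_of_windowedHybrid`).
[folklore] -/
theorem tendsto_neg_log_one_sub {η : ℕ → ℝ} (hη : Tendsto η atTop (𝓝 0)) :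
    Tendsto (fun w => -Real.log (1 - η w)) atTop (𝓝 0) := by
  have h1 : Tendsto (fun w => 1 - η w) atTop (𝓝 1) := by simpa using hη.const_sub 1
  have := ((Real.continuousAt_log one_ne_zero).tendsto.comp h1).neg
  rw [Function.comp_def, Real.log_one, neg_zero] at this
  exact this

/-- **THE SEQUENCE-INDEXED SOCKET ⟹ PAIR-CAUCHY.**  Labels `T K`, run-`K` terms `A K t`, finer runs fibre-summed
`B K K′ t` (`Z K′ t = Σ_{T K} B K K′ t` for `K ≤ K′`), positivity; and FOR EVERY window depth `w` AND EVERY offset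
sequence `ν`: a bad class `Bad w ν K t ⊆ T K` of relative weight `≤ W w ν K` in run `K` and in run `K + ν K`
fibre-summed, `W w ν K < 1`, `W w ν K ≤ η w` eventually in `K`; road P1's `GoodClause` for `(A, K ↦ B K (K + ν K))`
off that class with a remainder `δ w ν K → 0` THAT MAY DEPEND ON `ν`; and `η w < 1`, `η → 0`.  THEN for every `ε > 0`
all pairs `K₀ ≤ K ≤ K′` match modulo a `t`-independent constant within `ε`.  Proof: the window first (`−log(1 − η w)
< ε∕2`), then §1's pairs form at that window.  No common, `ν`-free majorant is assumed. [folklore] -/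
theorem pairCauchy_of_seqOffsetGoodClauses {Bad : ℕ → (ℕ → ℕ) → ℕ → ℝ → Finset ι}
    {δ W : ℕ → (ℕ → ℕ) → ℕ → ℝ} {η : ℕ → ℝ}
    (hZA : ∀ (K : ℕ) (t : ℝ), |t| ≤ l₀ → Z K t = ∑ τ ∈ T K, A K t τ)
    (hZB : ∀ (K K' : ℕ) (t : ℝ), K ≤ K' → |t| ≤ l₀ → Z K' t = ∑ τ ∈ T K, B K K' t τ)
    (hpos : ∀ (K : ℕ) (t : ℝ), |t| ≤ l₀ → 0 < ∑ τ ∈ T K, A K t τ) (hW1 : ∀ w ν K, W w ν K < 1)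
    (hA : ∀ K t, |t| ≤ l₀ → ∀ τ ∈ T K, 0 ≤ A K t τ)
    (hB : ∀ K K' t, K ≤ K' → |t| ≤ l₀ → ∀ τ ∈ T K, 0 ≤ B K K' t τ)
    (hbad : ∀ w ν K t, |t| ≤ l₀ → Bad w ν K t ⊆ T K)
    (hWA : ∀ w ν K t, |t| ≤ l₀ → ∑ τ ∈ Bad w ν K t, A K t τ ≤ W w ν K * ∑ τ ∈ T K, A K t τ)
    (hWB : ∀ w ν K t, |t| ≤ l₀ →
      ∑ τ ∈ Bad w ν K t, B K (K + ν K) t τ ≤ W w ν K * ∑ τ ∈ T K, B K (K + ν K) t τ)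
    (hgood : ∀ w ν, GoodClause l₀ vol T A (fun K => B K (K + ν K)) (Bad w ν) (δ w ν))
    (hδ : ∀ w ν, Tendsto (δ w ν) atTop (𝓝 0)) (hWη : ∀ w ν, ∀ᶠ K in atTop, W w ν K ≤ η w)
    (hη1 : ∀ w, η w < 1) (hη : Tendsto η atTop (𝓝 0)) :
    ∀ ε : ℝ, 0 < ε → ∃ K₀ : ℕ, ∀ K K' : ℕ, K₀ ≤ K → K ≤ K' →
      ∃ c : ℝ, ∀ t : ℝ, |t| ≤ l₀ → |Real.log (Z K' t) - Real.log (Z K t) - c| ≤ ε := by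
  intro ε hε
  -- Step 1: the window, `−log(1 − η w) < ε∕2`.
  obtain ⟨w, hw⟩ := (Metric.tendsto_atTop.1 (tendsto_neg_log_one_sub hη)) (ε / 2) (half_pos hε)
  have hw' := hw w le_rfl
  rw [Real.dist_eq, sub_zero] at hw'
  have hlogw : -Real.log (1 - η w) < ε / 2 := lt_of_le_of_lt (le_abs_self _) hw'
  -- Step 2: §1's pairs form — it suffices to be eventually good along EVERY offset sequence.
  refine (pairs_eventually_iff_forall_seq
    (Q := fun K K' => ∃ c : ℝ, ∀ t : ℝ, |t| ≤ l₀ → |Real.log (Z K' t) - Real.log (Z K t) - c| ≤ ε)).2 fun ν => ?_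
  have hD2 : ∀ᶠ K in atTop, vol * δ w ν K ≤ ε / 2 := by
    have : Tendsto (fun K => vol * δ w ν K) atTop (𝓝 0) := by simpa using (hδ w ν).const_mul vol
    exact this.eventually (Iic_mem_nhds (half_pos hε))
  filter_upwards [hD2, hWη w ν] with K hDK hWK
  obtain ⟨c, hc⟩ := pairBound_of_seqGoodClause ν hZA hZB hpos (hW1 w ν) hA hB (hbad w ν) (hWA w ν) (hWB w ν)
    (hgood w ν) K
  refine ⟨c, fun t ht => (hc t ht).trans ?_⟩
  have hmono : -Real.log (1 - W w ν K) ≤ -Real.log (1 - η w) := by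
    have h1 : 0 < 1 - η w := by linarith [hη1 w]
    have h2 : 1 - η w ≤ 1 - W w ν K := by linarith
    exact neg_le_neg (Real.log_le_log h1 h2)
  linarith

end Seq

/-! ## §3 The K-ONLY printed type with sequence-indexed remainders; exits at node U6 ∕ U0 by name -/

section KOnly

variable {ι : Type*} [DecidableEq ι] {l₀ vol : ℝ} {T : ℕ → Finset ι} {A : ℕ → ℝ → ι → ℝ}
  {B : ℕ → ℕ → ℝ → ι → ℝ} {Z : ℕ → ℝ → ℝ}

/-- **K-ONLY BAD CLASSES, SEQUENCE-INDEXED REMAINDERS ⟹ PAIR-CAUCHY.**  The data of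
`NE7PairwiseOffsetEndWindow.pairCauchy_of_kOnlyBadClasses` (bad class `Bad w K t ⊆ T K` of run `K`'s label alone,
ONE-RUN weight `W w K` in run `K`, ONE inequality for every finer run, `W w K < 1`, `W w K ≤ η w` eventually, `η w < 1`,
`η → 0`) EXCEPT that the good clause is asked along every offset SEQUENCE `ν` with its own remainder `δ w ν K → 0` — no
`ν`-free remainder.  Same conclusion. [folklore] -/
theorem pairCauchy_of_seqKOnlyBadClasses {Bad : ℕ → ℕ → ℝ → Finset ι} {δ : ℕ → (ℕ → ℕ) → ℕ → ℝ}
    {W : ℕ → ℕ → ℝ} {η : ℕ → ℝ}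
    (hZA : ∀ (K : ℕ) (t : ℝ), |t| ≤ l₀ → Z K t = ∑ τ ∈ T K, A K t τ)
    (hZB : ∀ (K K' : ℕ) (t : ℝ), K ≤ K' → |t| ≤ l₀ → Z K' t = ∑ τ ∈ T K, B K K' t τ)
    (hpos : ∀ (K : ℕ) (t : ℝ), |t| ≤ l₀ → 0 < ∑ τ ∈ T K, A K t τ) (hW1 : ∀ w K, W w K < 1)
    (hA : ∀ K t, |t| ≤ l₀ → ∀ τ ∈ T K, 0 ≤ A K t τ)
    (hB : ∀ K K' t, K ≤ K' → |t| ≤ l₀ → ∀ τ ∈ T K, 0 ≤ B K K' t τ)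
    (hbad : ∀ w K t, |t| ≤ l₀ → Bad w K t ⊆ T K)
    (hWA : ∀ w K t, |t| ≤ l₀ → ∑ τ ∈ Bad w K t, A K t τ ≤ W w K * ∑ τ ∈ T K, A K t τ)
    (hWB : ∀ w K K' t, K ≤ K' → |t| ≤ l₀ → ∑ τ ∈ Bad w K t, B K K' t τ ≤ W w K * ∑ τ ∈ T K, B K K' t τ)
    (hgood : ∀ w (ν : ℕ → ℕ), GoodClause l₀ vol T A (fun K => B K (K + ν K)) (Bad w) (δ w ν))
    (hδ : ∀ w ν, Tendsto (δ w ν) atTop (𝓝 0)) (hWη : ∀ w, ∀ᶠ K in atTop, W w K ≤ η w) (hη1 : ∀ w, η w < 1)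
    (hη : Tendsto η atTop (𝓝 0)) :
    ∀ ε : ℝ, 0 < ε → ∃ K₀ : ℕ, ∀ K K' : ℕ, K₀ ≤ K → K ≤ K' →
      ∃ c : ℝ, ∀ t : ℝ, |t| ≤ l₀ → |Real.log (Z K' t) - Real.log (Z K t) - c| ≤ ε :=
  pairCauchy_of_seqOffsetGoodClauses (Bad := fun w _ K t => Bad w K t) (W := fun w _ K => W w K) hZA hZB hpos
    (fun w _ K => hW1 w K) hA hB (fun w _ K t ht => hbad w K t ht) (fun w _ K t ht => hWA w K t ht)
    (fun w ν K t ht => hWB w K (K + ν K) t (Nat.le_add_right K (ν K)) ht) hgood hδ (fun w _ => hWη w) hη1 hη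

end KOnly

section Exit

open Missing T4Continuum T4Assembly

variable {G : Type*} [GaugeGroup G] [MeasurableSpace G] [HaarData G] {O : Type*}

/-- **NODE U6 FROM K-ONLY DATA WITH SEQUENCE-INDEXED REMAINDERS.**  Per string `os`: labels `T`, run-`K` terms `A`,
finer runs fibre-summed `B K K′`, K-only windowed bad classes with one-run weights `W w K` (`< 1`, `≤ η w` eventually,
`η w < 1`, `η → 0`), and for every window `w` and every offset SEQUENCE `ν` road P1's good clause for
`(A, K ↦ B K (K + ν K))` with a remainder `δ w ν K → 0` ⟹ `GenFunCauchy S l₀`. [folklore] -/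
theorem genFunCauchy_of_seqKOnlyBadClasses {ι : Type*} [DecidableEq ι] (S : TorusScheme G O) {l₀ : ℝ}
    (hl₀ : 0 ≤ l₀)
    (h : ∀ os : List O, ∃ (vol : ℝ) (T : ℕ → Finset ι) (A : ℕ → ℝ → ι → ℝ) (B : ℕ → ℕ → ℝ → ι → ℝ)
      (Bad : ℕ → ℕ → ℝ → Finset ι) (δ : ℕ → (ℕ → ℕ) → ℕ → ℝ) (W : ℕ → ℕ → ℝ) (η : ℕ → ℝ),
      (∀ w ν, Tendsto (δ w ν) atTop (𝓝 0)) ∧ (∀ w, ∀ᶠ K in atTop, W w K ≤ η w) ∧ (∀ w, η w < 1) ∧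
      Tendsto η atTop (𝓝 0) ∧ (∀ w K, W w K < 1) ∧
      (∀ (K : ℕ) (t : ℝ), |t| ≤ l₀ → T4GenFunBounds.schemeZ S os K t = ∑ τ ∈ T K, A K t τ) ∧
      (∀ (K K' : ℕ) (t : ℝ), K ≤ K' → |t| ≤ l₀ → T4GenFunBounds.schemeZ S os K' t = ∑ τ ∈ T K, B K K' t τ) ∧
      (∀ (K : ℕ) (t : ℝ), |t| ≤ l₀ → 0 < ∑ τ ∈ T K, A K t τ) ∧
      (∀ K t, |t| ≤ l₀ → ∀ τ ∈ T K, 0 ≤ A K t τ) ∧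
      (∀ K K' t, K ≤ K' → |t| ≤ l₀ → ∀ τ ∈ T K, 0 ≤ B K K' t τ) ∧
      (∀ w K t, |t| ≤ l₀ → Bad w K t ⊆ T K) ∧
      (∀ w K t, |t| ≤ l₀ → ∑ τ ∈ Bad w K t, A K t τ ≤ W w K * ∑ τ ∈ T K, A K t τ) ∧
      (∀ w K K' t, K ≤ K' → |t| ≤ l₀ → ∑ τ ∈ Bad w K t, B K K' t τ ≤ W w K * ∑ τ ∈ T K, B K K' t τ) ∧
      (∀ w (ν : ℕ → ℕ), GoodClause l₀ vol T A (fun K => B K (K + ν K)) (Bad w) (δ w ν))) :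
    GenFunCauchy S l₀ := by
  intro os t ht
  obtain ⟨vol, T, A, B, Bad, δ, W, η, hδ, hWη, hη1, hη, hW1, hZA, hZB, hpos, hA, hB, hbad, hWA, hWB, hgood⟩ := h os
  exact cauchySeq_genFun_of_pairCauchy hl₀
    (pairCauchy_of_seqKOnlyBadClasses hZA hZB hpos hW1 hA hB hbad hWA hWB hgood hδ hWη hη1 hη) ht

/-- … and NODE U0 (`Missing.HasContinuumLimit S`) by `T4Assembly.hasContinuumLimit_of_genFunCauchy`. [folklore] -/
theorem hasContinuumLimit_of_seqKOnlyBadClasses [RegularGaugeGroup G] {ι : Type*} [DecidableEq ι]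
    (S : TorusScheme G O) (hβ : ∀ K, 0 ≤ S.β K) (hm : ∀ K o, Measurable (S.obs K o))
    (h1 : ∀ K o U, |S.obs K o U| ≤ 1) {l₀ : ℝ} (hl₀ : 0 < l₀)
    (h : ∀ os : List O, ∃ (vol : ℝ) (T : ℕ → Finset ι) (A : ℕ → ℝ → ι → ℝ) (B : ℕ → ℕ → ℝ → ι → ℝ)
      (Bad : ℕ → ℕ → ℝ → Finset ι) (δ : ℕ → (ℕ → ℕ) → ℕ → ℝ) (W : ℕ → ℕ → ℝ) (η : ℕ → ℝ),
      (∀ w ν, Tendsto (δ w ν) atTop (𝓝 0)) ∧ (∀ w, ∀ᶠ K in atTop, W w K ≤ η w) ∧ (∀ w, η w < 1) ∧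
      Tendsto η atTop (𝓝 0) ∧ (∀ w K, W w K < 1) ∧
      (∀ (K : ℕ) (t : ℝ), |t| ≤ l₀ → T4GenFunBounds.schemeZ S os K t = ∑ τ ∈ T K, A K t τ) ∧
      (∀ (K K' : ℕ) (t : ℝ), K ≤ K' → |t| ≤ l₀ → T4GenFunBounds.schemeZ S os K' t = ∑ τ ∈ T K, B K K' t τ) ∧
      (∀ (K : ℕ) (t : ℝ), |t| ≤ l₀ → 0 < ∑ τ ∈ T K, A K t τ) ∧
      (∀ K t, |t| ≤ l₀ → ∀ τ ∈ T K, 0 ≤ A K t τ) ∧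
      (∀ K K' t, K ≤ K' → |t| ≤ l₀ → ∀ τ ∈ T K, 0 ≤ B K K' t τ) ∧
      (∀ w K t, |t| ≤ l₀ → Bad w K t ⊆ T K) ∧
      (∀ w K t, |t| ≤ l₀ → ∑ τ ∈ Bad w K t, A K t τ ≤ W w K * ∑ τ ∈ T K, A K t τ) ∧
      (∀ w K K' t, K ≤ K' → |t| ≤ l₀ → ∑ τ ∈ Bad w K t, B K K' t τ ≤ W w K * ∑ τ ∈ T K, B K K' t τ) ∧
      (∀ w (ν : ℕ → ℕ), GoodClause l₀ vol T A (fun K => B K (K + ν K)) (Bad w) (δ w ν))) :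
    Missing.HasContinuumLimit S :=
  hasContinuumLimit_of_genFunCauchy S hβ hm h1 hl₀ (genFunCauchy_of_seqKOnlyBadClasses S hl₀.le h)

end Exit

/-! ## §4 Consistency: p259223's constant-offset socket is the case `ν ≡ n` -/

section Const

variable {ι : Type*} [DecidableEq ι] {l₀ vol : ℝ} {T : ℕ → Finset ι} {A : ℕ → ℝ → ι → ℝ}
  {B : ℕ → ℕ → ℝ → ι → ℝ} {Z : ℕ → ℝ → ℝ}

/-- Good clauses for every CONSTANT offset with one remainder give good clauses along every offset SEQUENCE with that
remainder (read the clause of offset `ν K` at index `K`). [folklore] -/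
theorem goodClause_seq_of_const {Bd : ℕ → ℝ → Finset ι} {δ₀ : ℕ → ℝ}
    (hgood : ∀ n : ℕ, GoodClause l₀ vol T A (fun K => B K (K + n)) Bd δ₀) (ν : ℕ → ℕ) :
    GoodClause l₀ vol T A (fun K => B K (K + ν K)) Bd δ₀ :=
  fun K => hgood (ν K) K

/-- **`NE7PairwiseOffsetEndWindow.pairCauchy_of_kOnlyBadClasses` RE-DERIVED** from §3 (same statement up to the unused
hypothesis `0 < vol`, which the sequence socket does not need): the constant-offset hypotheses imply the sequence-indexed
ones with `δ w ν := δ w`.  The new socket is a generalisation, not a variant. [folklore] -/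
theorem pairCauchy_of_kOnlyBadClasses' {Bad : ℕ → ℕ → ℝ → Finset ι} {δ W : ℕ → ℕ → ℝ} {η : ℕ → ℝ}
    (hZA : ∀ (K : ℕ) (t : ℝ), |t| ≤ l₀ → Z K t = ∑ τ ∈ T K, A K t τ)
    (hZB : ∀ (K K' : ℕ) (t : ℝ), K ≤ K' → |t| ≤ l₀ → Z K' t = ∑ τ ∈ T K, B K K' t τ)
    (hpos : ∀ (K : ℕ) (t : ℝ), |t| ≤ l₀ → 0 < ∑ τ ∈ T K, A K t τ) (hW1 : ∀ w K, W w K < 1)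
    (hA : ∀ K t, |t| ≤ l₀ → ∀ τ ∈ T K, 0 ≤ A K t τ)
    (hB : ∀ K K' t, K ≤ K' → |t| ≤ l₀ → ∀ τ ∈ T K, 0 ≤ B K K' t τ)
    (hbad : ∀ w K t, |t| ≤ l₀ → Bad w K t ⊆ T K)
    (hWA : ∀ w K t, |t| ≤ l₀ → ∑ τ ∈ Bad w K t, A K t τ ≤ W w K * ∑ τ ∈ T K, A K t τ)
    (hWB : ∀ w K K' t, K ≤ K' → |t| ≤ l₀ → ∑ τ ∈ Bad w K t, B K K' t τ ≤ W w K * ∑ τ ∈ T K, B K K' t τ)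
    (hgood : ∀ w n : ℕ, GoodClause l₀ vol T A (fun K => B K (K + n)) (fun K => Bad w K) (δ w))
    (hδ : ∀ w, Tendsto (δ w) atTop (𝓝 0)) (hWη : ∀ w, ∀ᶠ K in atTop, W w K ≤ η w) (hη1 : ∀ w, η w < 1)
    (hη : Tendsto η atTop (𝓝 0)) :
    ∀ ε : ℝ, 0 < ε → ∃ K₀ : ℕ, ∀ K K' : ℕ, K₀ ≤ K → K ≤ K' →
      ∃ c : ℝ, ∀ t : ℝ, |t| ≤ l₀ → |Real.log (Z K' t) - Real.log (Z K t) - c| ≤ ε :=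
  pairCauchy_of_seqKOnlyBadClasses (δ := fun w _ => δ w) hZA hZB hpos hW1 hA hB hbad hWA hWB
    (fun w ν => goodClause_seq_of_const (hgood w) ν) (fun w _ => hδ w) hWη hη1 hη

end Const

end Summit.QuantumFields.BalabanUV.T4Continuum.NE7PairwiseOffsetEndSeq

end
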